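import Literature.Claims.NS.Bazarbekov2020

/-!
# C42 `Bazarbekov2020` — kernel refutation of Step 2 (`Step2_Theorem31`, Theorem 3.1 (3,5) p.11:
# the superlinear Volterra inequality (3,4) does not bound `‖w‖_{L₂(0,T)}` by `√2‖f‖_{L₂(0,T)}`)

Cell `ns-claims` (D-0090 NS-CLAIMS SWEEP), claim C42; typed skeleton `Literature.Claims.NS.Bazarbekov2020`
(p479582, typist-4 g2). KIT written by the typist (kernel author ns-claims-typist-4 g2; one-theorem variant
`.step2only`), ADOPTED as the kill file of record by the refuter of record ns-claims-refuter-6 after re-check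
(headline type fully qualified; no other change); filed by the salvage lane (conv. (b)); the VERDICT/REF words
are the refuter's/referee's. Text of record: A. Bazarbekov, arXiv:2002.05360 v1
[Bazarbekov2020], Theorem 3.1, TeX l.714–719 / p.11: «For all functions `w(t) ∈ L₂(0,T)` satisfying the
inequality (3,4) [`w(t) < f(t) + b₁∫₀ᵗ w²(τ)(t − τ)^{−μ}dτ`] the following estimate holds:
`‖w(t)‖_{L₂(0,T)} < √2·‖f(t)‖_{L₂(0,T)}` (3,5). This estimate does not depends on the number `b₁` in (3,4).»

WHAT IS PROVED: `not_Step2_Theorem31 : ¬ Step2_Theorem31`, by the explicit instance `μ = 5/8`, `b₁ = 1`,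
`T = 1`, `f ≡ 8`, `w(t) = 4 + K·min(|t|^{3/8}, 1)`, `K = 128/3`: on `(0,1]`, `w(t) = 4 + K t^{3/8}` and
`∫₀ᵗ w²(τ)(t − τ)^{−5/8}dτ ≥ 16·∫₀ᵗ(t − τ)^{−5/8}dτ = (128/3)·t^{3/8}`, so (3,4) holds with room `4`; but
`w(t) ≥ K t` on `(0,1)` gives `‖w‖²_{L₂(0,1)} ≥ K²/3 = 16384/27 > 256`, i.e. `‖w‖_{L₂(0,1)} > 16 > 8√2 =
√2‖f‖_{L₂(0,1)}`. (Any `b₁ > 0` works the same way with `f ≡ δ`, `w = δ/2 + b₁δ²t^{1−μ}/(4(1−μ))`, `δ` large —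
CARD §4.) Class (refuter to confirm after the referee's charitable re-typing): false lemma (countermodel);
ref-2 g2 PRE-READ 01:10:06Z: `Step2_Theorem31` FAITHFUL, locator candidate = Step 2. The earlier printed inference
(3,4'') (`Step1b_Ineq34pp`, p.10) is false at the abstract grain but true in its charitable per-time-slice form and
is not consumed by `claim_of_steps` — not attacked in this one-theorem variant (see the two-theorem file for the
abstract-grain record). Steps 1a/1 (solution-level Green-function bounds) not attacked.

Closed terms; axioms `propext`, `Classical.choice`, `Quot.sound`.

WHAT THIS IS NOT: not a claim about NS regularity or blow-up; not a claim about any author beyond the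
typed locator.
-/

-- The summit's canonical theorem namespace repeats the summit name (single-conjunct summit).
set_option linter.dupNamespace false

noncomputable section

open Set MeasureTheory intervalIntegral

namespace Summit.NavierStokesRegularity.NavierStokesRegularity.Theorems.Bazarbekov2020

open Literature.Claims.NS.Bazarbekov2020

/-! ## The witness -/

/-- `K = 128/3 = 16/(3/8)`. -/
def K : ℝ := 128 / 3

/-- The witness `w(t) = 4 + K·min(|t|^{3/8}, 1)` (`= 4 + K t^{3/8}` on `(0,1]`; bounded and continuous on `ℝ`). -/
def wit (t : ℝ) : ℝ := 4 + K * min (|t| ^ (3 / 8 : ℝ)) 1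

/-- The forcing size `f ≡ 8`. -/
def fc (_t : ℝ) : ℝ := 8

/-- `K > 0`. -/
lemma K_pos : 0 < K := by unfold K; norm_num

/-- `w` is continuous. -/
lemma wit_continuous : Continuous wit := by
  unfold wit
  exact continuous_const.add (continuous_const.mul
    (((Real.continuous_rpow_const (by norm_num)).comp continuous_abs).min continuous_const))

/-- `4 ≤ w`. -/
lemma four_le_wit (t : ℝ) : 4 ≤ wit t := by
  unfold wit
  have h : 0 ≤ min (|t| ^ (3 / 8 : ℝ)) 1 := le_min (Real.rpow_nonneg (abs_nonneg t) _) zero_le_one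
  nlinarith [K_pos]

/-- `0 ≤ w`. -/
lemma wit_nonneg (t : ℝ) : 0 ≤ wit t := le_trans (by norm_num) (four_le_wit t)

/-- `w ≤ 4 + K`. -/
lemma wit_le (t : ℝ) : wit t ≤ 4 + K := by
  unfold wit
  have h : min (|t| ^ (3 / 8 : ℝ)) 1 ≤ 1 := min_le_right _ _
  nlinarith [K_pos]

/-- On `(0,1]`: `w(t) = 4 + K t^{3/8}`. -/
lemma wit_eq {t : ℝ} (ht : t ∈ Ioc (0 : ℝ) 1) : wit t = 4 + K * t ^ (3 / 8 : ℝ) := by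
  unfold wit
  rw [abs_of_pos ht.1, min_eq_left (Real.rpow_le_one ht.1.le ht.2 (by norm_num))]

/-- On `(0,1]`: `K t ≤ w(t)` (since `t ≤ t^{3/8}` there). -/
lemma K_mul_le_wit {t : ℝ} (ht : t ∈ Ioc (0 : ℝ) 1) : K * t ≤ wit t := by
  rw [wit_eq ht]
  have h1 : t ≤ t ^ (3 / 8 : ℝ) := by
    have := Real.rpow_le_rpow_of_exponent_ge ht.1 ht.2 (show (3 / 8 : ℝ) ≤ 1 by norm_num)
    rwa [Real.rpow_one] at this
  nlinarith [K_pos]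

/-- `w²` is integrable on `(0,1)`. -/
lemma wit_sq_integrableOn : IntegrableOn (fun t => wit t ^ 2) (Ioo (0 : ℝ) 1) :=
  ((wit_continuous.pow 2).integrableOn_Icc (a := 0) (b := 1)).mono_set Ioo_subset_Icc_self

/-- `f²` is integrable on `(0,1)`. -/
lemma fc_sq_integrableOn : IntegrableOn (fun t => fc t ^ 2) (Ioo (0 : ℝ) 1) :=
  ((continuous_const : Continuous fun _ : ℝ => (8 : ℝ) ^ 2).integrableOn_Icc (a := 0) (b := 1)).mono_set
    Ioo_subset_Icc_self

/-! ## The Abel kernel `(t − τ)^{−5/8}` -/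

/-- The kernel is interval-integrable on `[0,t]`. -/
lemma kernel_intervalIntegrable (t : ℝ) :
    IntervalIntegrable (fun τ => (t - τ) ^ (-(5 / 8) : ℝ)) volume 0 t := by
  have h := (intervalIntegral.intervalIntegrable_rpow' (a := t) (b := 0)
    (show (-1 : ℝ) < -(5 / 8) by norm_num)).comp_sub_left t
  simpa using h

/-- The kernel is integrable on `(0,t)`. -/
lemma kernel_integrableOn {t : ℝ} (ht : 0 < t) :
    IntegrableOn (fun τ => (t - τ) ^ (-(5 / 8) : ℝ)) (Ioo 0 t) :=
  (((intervalIntegrable_iff_integrableOn_Ioc_of_le ht.le).mp (kernel_intervalIntegrable t)).mono_set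
    Ioo_subset_Ioc_self)

/-- `∫₀ᵗ (t − τ)^{−5/8} dτ = t^{3/8}/(3/8)`. -/
lemma kernel_integral {t : ℝ} (ht : 0 < t) :
    ∫ τ in Ioo 0 t, (t - τ) ^ (-(5 / 8) : ℝ) = t ^ (3 / 8 : ℝ) / (3 / 8 : ℝ) := by
  rw [← integral_Ioc_eq_integral_Ioo, ← intervalIntegral.integral_of_le ht.le,
    intervalIntegral.integral_comp_sub_left (fun x => x ^ (-(5 / 8) : ℝ)) t, sub_self, sub_zero,
    integral_rpow (Or.inl (by norm_num))]
  have h : (-(5 / 8) : ℝ) + 1 = 3 / 8 := by norm_num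
  rw [h, Real.zero_rpow (by norm_num), sub_zero]

/-- Lower bound of the Volterra term: `K·t^{3/8} ≤ ∫₀ᵗ w²(τ)(t − τ)^{−5/8} dτ` for `t > 0`. -/
lemma volterra_lb {t : ℝ} (ht : 0 < t) :
    K * t ^ (3 / 8 : ℝ) ≤ ∫ τ in Ioo 0 t, wit τ ^ 2 * (t - τ) ^ (-(5 / 8) : ℝ) := by
  have hg := kernel_integrableOn ht
  have h16 : IntegrableOn (fun τ => (16 : ℝ) * (t - τ) ^ (-(5 / 8) : ℝ)) (Ioo 0 t) := hg.const_mul 16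
  have hwg : IntegrableOn (fun τ => wit τ ^ 2 * (t - τ) ^ (-(5 / 8) : ℝ)) (Ioo 0 t) := by
    refine Integrable.bdd_mul (c := (4 + K) ^ 2) hg
      (wit_continuous.pow 2).aestronglyMeasurable (ae_of_all _ fun τ => ?_)
    rw [Real.norm_eq_abs, abs_of_nonneg (sq_nonneg _)]
    exact pow_le_pow_left₀ (wit_nonneg τ) (wit_le τ) 2
  have hmono : ∫ τ in Ioo 0 t, (16 : ℝ) * (t - τ) ^ (-(5 / 8) : ℝ) ≤
      ∫ τ in Ioo 0 t, wit τ ^ 2 * (t - τ) ^ (-(5 / 8) : ℝ) := by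
    refine setIntegral_mono_on h16 hwg measurableSet_Ioo fun τ hτ => ?_
    have hk : 0 ≤ (t - τ) ^ (-(5 / 8) : ℝ) := Real.rpow_nonneg (by linarith [hτ.2]) _
    have hw : (16 : ℝ) ≤ wit τ ^ 2 := by nlinarith [four_le_wit τ]
    exact mul_le_mul_of_nonneg_right hw hk
  have hval : ∫ τ in Ioo 0 t, (16 : ℝ) * (t - τ) ^ (-(5 / 8) : ℝ) = K * t ^ (3 / 8 : ℝ) := by
    rw [MeasureTheory.integral_const_mul, kernel_integral ht]
    unfold K; ring
  linarith

/-- The witness satisfies (3,4) with `μ = 5/8`, `b₁ = 1`, `T = 1`, `f ≡ 8`. -/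
lemma ineq34_wit : Ineq34 (5 / 8) 1 1 wit fc := by
  intro t ht
  rw [wit_eq ht]
  have h := volterra_lb ht.1
  have hneg : (-(5 / 8 : ℝ)) = (-(5 / 8) : ℝ) := by norm_num
  simp only [fc, one_mul]
  rw [hneg]
  linarith

/-! ## The `L₂(0,1)` norms -/

/-- `‖f‖_{L₂(0,1)} = 8`. -/
lemma l2_fc : l2 1 fc = 8 := by
  unfold l2 fc
  rw [setIntegral_const, Real.volume_real_Ioo_of_le zero_le_one, sub_zero, one_smul]
  exact Real.sqrt_sq (by norm_num)

/-- `∫₀¹ K²τ² dτ = K²/3`. -/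
lemma integral_K_sq : ∫ τ in Ioo (0 : ℝ) 1, K ^ 2 * τ ^ 2 = K ^ 2 / 3 := by
  rw [← integral_Ioc_eq_integral_Ioo, ← intervalIntegral.integral_of_le zero_le_one,
    intervalIntegral.integral_const_mul, integral_pow]
  norm_num
  ring

/-- `16 ≤ ‖w‖_{L₂(0,1)}`. -/
lemma sixteen_le_l2_wit : 16 ≤ l2 1 wit := by
  unfold l2
  have hK2 : IntegrableOn (fun τ : ℝ => K ^ 2 * τ ^ 2) (Ioo (0 : ℝ) 1) :=
    ((continuous_const.mul (continuous_id.pow 2)).integrableOn_Icc (a := 0) (b := 1)).mono_set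
      Ioo_subset_Icc_self
  have hmono : ∫ τ in Ioo (0 : ℝ) 1, K ^ 2 * τ ^ 2 ≤ ∫ τ in Ioo (0 : ℝ) 1, wit τ ^ 2 := by
    refine setIntegral_mono_on hK2 wit_sq_integrableOn measurableSet_Ioo fun τ hτ => ?_
    have h1 := K_mul_le_wit ⟨hτ.1, hτ.2.le⟩
    have h0 : 0 ≤ K * τ := mul_nonneg K_pos.le hτ.1.le
    nlinarith
  rw [integral_K_sq] at hmono
  have h256 : (256 : ℝ) ≤ K ^ 2 / 3 := by unfold K; norm_num
  exact Real.le_sqrt_of_sq_le (by linarith)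

/-! ## The refutation -/

/-- **Theorem 3.1 as printed is false** (`Step2_Theorem31` of the skeleton): the instance `μ = 5/8`,
`b₁ = 1`, `T = 1`, `f ≡ 8`, `w = 4 + (128/3)·min(|t|^{3/8},1)` satisfies (3,4) on `(0,1]` and all the
typed side conditions, yet `‖w‖_{L₂(0,1)} ≥ 16 > 8√2 = √2‖f‖_{L₂(0,1)}`.
[cite: Bazarbekov2020, Thm 3.1 (3,5) l.714–719 p.11; (3,4) l.653–658 p.10] -/
theorem not_Step2_Theorem31 : ¬ Literature.Claims.NS.Bazarbekov2020.Step2_Theorem31 := by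
  intro h
  have hlt := h (5 / 8) 1 1 le_rfl (by norm_num) one_pos one_pos wit fc wit_nonneg
    (fun _ => by norm_num [fc]) wit_sq_integrableOn fc_sq_integrableOn ineq34_wit
  rw [l2_fc] at hlt
  have h16 := sixteen_le_l2_wit
  have h4 : Real.sqrt 4 = 2 := by
    rw [show (4 : ℝ) = 2 ^ 2 by norm_num]
    exact Real.sqrt_sq (by norm_num)
  have hs : Real.sqrt 2 < 2 :=
    calc Real.sqrt 2 < Real.sqrt 4 := Real.sqrt_lt_sqrt (by norm_num) (by norm_num)
      _ = 2 := h4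
  linarith



end Summit.NavierStokesRegularity.NavierStokesRegularity.Theorems.Bazarbekov2020

end
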